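import Literature.NumberTheory.LFunctions.MertensSecondChainCheck
import Literature.NumberTheory.LFunctions.ThetaChainSound
import Literature.NumberTheory.LFunctions.ChainTableFacts
import Literature.NumberTheory.LFunctions.RosserSchoenfeldMertensChainSound
import Literature.NumberTheory.LFunctions.MertensConstant
import Literature.Analysis.SpecialFunctions.KernelLog
import Literature.Analysis.SpecialFunctions.EulerMascheroniBounds
import HarnessLib

/-!
# RH-FREE kernel certificate — «nothing here bears on the truth of RH»
# The error term of Mertens' second theorem is positive below `358 811`: soundness of the checker

Topic: `Literature/NumberTheory/LFunctions`. The semantic soundness of the `E₂`-chain checker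
`MertensSecondChainCheck.lean` over the complete prime table `ChainTable.table` (`ChainTableFacts.tableOK`), for
the inequality `Σ_{q ≤ x} 1/q − log log x − B > 0` (`B` the Meissel–Mertens constant; Rosser–Schoenfeld 1962,
Thms 20–21: true for `2 ≤ x ≤ 10⁸`; quoted by Zhao 2025, §1.1, as «`E₂(x) > 0` for `2 ≤ x ≤ 10⁸`», the numerical
input of his Theorem 1). Everything here is PROVED (two `structure … : Prop`, the invariants); pattern and lemmas
follow `ThetaChainSound.lean`.

* `Inv s` (state at the prime `p = s.p ≥ 3`): `p` is a table entry and prime; `0 < Llo ≤ 2⁸⁰ log p ≤ Lhi`;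
  `2⁸⁰ log log p ≤ LL`; `S ≤ 2⁸⁰ Σ_{q ≤ p} 1/q`; and THE CLAIM: `MHI/2⁸⁰ + log log x < Σ_{q ≤ x} 1/q` for all real
  `3 ≤ x < p`.
* `step_inv`: one step `p → p'` preserves `Inv` (`p'` = table successor, prime by `ThetaChain.primeChk_sound`, no
  prime in `(p, p')` by completeness of the table; `logNext_sound`; `log log p' ≤ log log p + log(1 + (Lhi'−Llo)/Llo)`
  bounded by `ChainCheck.lnp_sound`; the comparison `MHI + LL' ≤ S` gives the claim on `[p, p')` since `Σ_{q≤x} 1/q`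
  is constant `= Σ_{q≤p} 1/q` there and `log log x < log log p'`); `run_sound`, `runD_sound`; `initE_inv` (the state
  at `p = 3`: one kernel logarithm of `Lhi₃` for `log log 3`).
* `lt_primeRecipSum_of_inv` — the claim read off a state.
* The Meissel–Mertens constant: `InvA`/`stepA_inv`/`runA_sound`/`initA_inv` for the accumulation of
  `a_q = log(1 + 1/(q−1)) − 1/q` (`= Mertens.primeLogCoeffSubInv q` at primes), and from any final accumulation
  state `⟨P, A, Ahi⟩`: **`B ≤ γ − (A + L2LON)/2⁸⁰ + 1/2`** (`meisselMertens_le_of_invA`; `γ − B = Σ_q a_q ≥ a_2 +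
  Σ_{3≤q≤P} a_q`, `a_2 = log 2 − 1/2`) and **`B ≥ γ − (Ahi + L2HIN)/2⁸⁰ + 1/2 − (log(P+1) − log P)`**
  (`le_meisselMertens_of_invA`; tail `Σ_{q > P} a_q ≤ log(P+1) − log P`, elementary telescoping). The numerical
  instances (`B < MHI/2⁸⁰ = 0.2614988…`, `0.26146 < B`) are drawn in `MertensSecondErrorPositive.lean` from the
  kernel fact `MertensSecondChainRun.runA_eq`.

## References
* J. B. Rosser, L. Schoenfeld, Illinois J. Math. 6 (1962), 64–94, Thms 20–21, (2.10) and p. 87. [RosserSchoenfeld1962]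
* T. Zhao, Res. Number Theory 11 (2025) 62, §1.1, §2. [Zhao2025MertensMean]
* G. H. Hardy, E. M. Wright, *An Introduction to the Theory of Numbers*, Thm 428, (22.8.1). [HardyWright2008]
-/

noncomputable section

namespace Literature.NumberTheory.LFunctions.MertensSecondChain

open ChainCheck ChainTable ThetaChain Real Finset Mertens
open Literature.Analysis.SpecialFunctions

/-! ### `Σ_{q ≤ x} 1/q` along the integers -/

/-- `Σ_{q ≤ x} 1/q` is constant on `[p, p')` when there is no prime in `(p, p')`: for real `p ≤ x < p'`,
`primeRecipSum x = Σ_{q ≤ p} 1/q`. [folklore] -/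
private theorem primeRecipSum_real_eq {p p' : ℕ} (hq : ∀ q : ℕ, p < q → q < p' → ¬ q.Prime) {x : ℝ}
    (hpx : (p : ℝ) ≤ x) (hxp : x < p') :
    primeRecipSum x = ∑ q ∈ Nat.primesLE p, (q : ℝ)⁻¹ := by
  have hx0 : 0 ≤ x := le_trans (Nat.cast_nonneg p) hpx
  unfold primeRecipSum
  have h1 : p ≤ ⌊x⌋₊ := Nat.le_floor hpx
  have h2 : ⌊x⌋₊ < p' := (Nat.floor_lt hx0).2 hxp
  exact MertensChain.sum_primesLE_eq_of_noPrime _ h1 fun q hq1 hq2 => hq q hq1 (by omega)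

/-! ### The invariant of the `E₂`-chain -/

/-- **The invariant** of a state of the `E₂`-chain (relative to the table `ChainTable.table`).
[cite: Zhao2025MertensMean, §1.1 («E_i(x) > 0 for 2 ≤ x ≤ 10⁸» [RS])] -/
structure Inv (s : ES) : Prop where
  /-- the prime reached is a table entry -/
  mem : s.p ∈ table
  /-- and is prime -/
  prime : s.p.Prime
  /-- and is at least `3` -/
  three_le : 3 ≤ s.p
  /-- `0 < Llo` -/
  Llo_pos : 0 < s.Llo
  /-- `Llo ≤ 2⁸⁰ log p` -/
  Llo_le : (s.Llo : ℝ) ≤ 2 ^ 80 * Real.log s.p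
  /-- `2⁸⁰ log p ≤ Lhi` -/
  le_Lhi : 2 ^ 80 * Real.log s.p ≤ s.Lhi
  /-- `2⁸⁰ log log p ≤ LL` -/
  loglog_le : 2 ^ 80 * Real.log (Real.log s.p) ≤ s.LL
  /-- `S ≤ 2⁸⁰ Σ_{q ≤ p} 1/q` -/
  S_le : (s.S : ℝ) ≤ 2 ^ 80 * ∑ q ∈ Nat.primesLE s.p, (q : ℝ)⁻¹
  /-- the claim below `p` -/
  claim : ∀ x : ℝ, 3 ≤ x → x < s.p → (MHI : ℝ) / 2 ^ 80 + Real.log (Real.log x) < primeRecipSum x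

/-! ### One step -/

/-- **Soundness of one step.** If `Inv s` holds, `p'` is the table successor of `s.p`, and `step s p' = some s'`,
then `Inv s'` and `s'.p = p'`. [cite: Zhao2025MertensMean, §1.1 («E_i(x) > 0 for 2 ≤ x ≤ 10⁸» [RS])] -/
theorem step_inv {s s' : ES} (hI : Inv s) {p' : ℕ} {rest : List ℕ}
    (hafter : after s.p table = p' :: rest) (h : step s p' = some s') : Inv s' ∧ s'.p = p' := by
  have hT := tableOK
  obtain ⟨p, Llo, Lhi, LL, S⟩ := s
  simp only at hafter hI
  obtain ⟨hmem, hprime, h3, hLlo0, hLlo, hLhi, hLL, hS, hclaim⟩ := hI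
  simp only at hmem hprime h3 hLlo0 hLlo hLhi hLL hS hclaim
  -- the successor `p'`
  obtain ⟨hp'T, hpp', hmin⟩ := head_after hT.sorted hafter
  have hp'le : p' ≤ 4599989 := hT.bounded p' hp'T
  have hnoprime : ∀ q : ℕ, p < q → q < p' → ¬ q.Prime := fun q h1 h2 hq =>
    absurd (hmin q (hT.complete q hq (by omega)) h1) (not_le.2 h2)
  have hp0 : 0 < p := hprime.pos
  -- unfold the step
  simp only [step, Nat.mul_eq, Nat.sub_eq, Nat.add_eq] at h
  obtain ⟨hg1, h⟩ := bif_not_none h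
  simp only [Bool.and_eq_true] at hg1
  obtain ⟨⟨-, hodd⟩, hchk⟩ := hg1
  have hodd' : Odd p' := Nat.odd_iff.2 (Nat.eq_of_beq_eq_true hodd)
  have hp'prime : p'.Prime := primeChk_sound hchk hodd' (by omega)
  rcases hln : logNext p Llo Lhi p' with _ | ⟨Llo', Lhi'⟩
  · rw [hln] at h; simp at h
  · rw [hln] at h
    simp only at h
    obtain ⟨hg2, h⟩ := bif_not_none h
    simp only [Bool.and_eq_true, Nat.blt_eq, Nat.ble_eq] at hg2
    obtain ⟨⟨hLlo'0, hLloLhi'⟩, h2d⟩ := hg2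
    rcases hlnp : lnp (Lhi' - Llo) Llo with ⟨dlo, dhi⟩
    rw [hlnp] at h
    simp only at h
    obtain ⟨hg3, h⟩ := bif_not_none h
    simp only [Nat.ble_eq] at hg3
    simp only [Option.some.injEq] at h
    subst h
    -- the new enclosures of `log p'`
    obtain ⟨hLlo', hLhi'⟩ := logNext_sound hln hp0 hpp'.le hLlo hLhi
    have hp'R1 : (1 : ℝ) < p' := by exact_mod_cast hp'prime.one_lt
    have hpR1 : (1 : ℝ) < p := by
      have : (3 : ℝ) ≤ p := by exact_mod_cast h3
      linarith
    have hlogp : 0 < Real.log (p : ℝ) := Real.log_pos hpR1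
    have hlogp' : 0 < Real.log (p' : ℝ) := Real.log_pos hp'R1
    have h80 : (0 : ℝ) < 2 ^ 80 := by positivity
    -- `log log p' ≤ log log p + log(1 + d/Llo) ≤ (LL + dhi)/2⁸⁰`
    have hLlo0R : (0 : ℝ) < Llo := by exact_mod_cast hLlo0
    have hdR : ((Lhi' - Llo : ℕ) : ℝ) = (Lhi' : ℝ) - Llo := by push_cast [Nat.cast_sub hLloLhi']; ring
    have hlnps := lnp_sound (p := Lhi' - Llo) (q := Llo) hLlo0 h2d
    rw [hlnp] at hlnps
    obtain ⟨-, hdhi⟩ := hlnps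
    rw [hdR] at hdhi
    have hLLnew : 2 ^ 80 * Real.log (Real.log (p' : ℝ)) ≤ ((LL + dhi : ℕ) : ℝ) := by
      -- `log log p' ≤ log (Lhi'/2^80)` and `log (Llo/2^80) ≤ log log p`
      have e1 : Real.log (Real.log (p' : ℝ)) ≤ Real.log ((Lhi' : ℝ) / 2 ^ 80) :=
        Real.log_le_log hlogp' (by rw [le_div_iff₀ h80]; linarith)
      have e2 : Real.log ((Llo : ℝ) / 2 ^ 80) ≤ Real.log (Real.log (p : ℝ)) :=
        Real.log_le_log (by positivity) (by rw [div_le_iff₀ h80]; linarith)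
      have e3 : Real.log ((Lhi' : ℝ) / 2 ^ 80) - Real.log ((Llo : ℝ) / 2 ^ 80) =
          Real.log (1 + ((Lhi' : ℝ) - Llo) / Llo) := by
        have hLhi'0 : (0 : ℝ) < Lhi' := by exact_mod_cast hLlo'0.trans_le (by
          have : (Llo' : ℝ) ≤ Lhi' := by linarith
          exact_mod_cast this)
        rw [Real.log_div hLhi'0.ne' h80.ne', Real.log_div hLlo0R.ne' h80.ne',
          show 1 + ((Lhi' : ℝ) - Llo) / Llo = (Lhi' : ℝ) / Llo by field_simp; ring,
          Real.log_div hLhi'0.ne' hLlo0R.ne']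
        ring
      push_cast
      nlinarith [e1, e2, e3, hdhi, hLL]
    -- the new sum
    have hsum' : ∑ q ∈ Nat.primesLE p', (q : ℝ)⁻¹ = (∑ q ∈ Nat.primesLE p, (q : ℝ)⁻¹) + (p' : ℝ)⁻¹ :=
      MertensChain.sum_primesLE_succ_prime (fun q : ℕ => (q : ℝ)⁻¹) hp'prime hpp' hnoprime
    have hp'0R : (0 : ℝ) < p' := by linarith
    have hdiv : ((SC / p' : ℕ) : ℝ) ≤ 2 ^ 80 * (p' : ℝ)⁻¹ := by
      have := (natDiv_real_bounds SC hp'prime.pos).1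
      rw [SC_real] at this
      simpa [div_eq_mul_inv] using this
    refine ⟨⟨hp'T, hp'prime, by simp only; omega, hLlo'0, hLlo', hLhi', hLLnew, ?_, ?_⟩, rfl⟩
    · -- `S + ⌊2⁸⁰/p'⌋ ≤ 2⁸⁰ Σ_{q ≤ p'} 1/q`
      simp only [natdiv_eq]
      push_cast
      rw [hsum']
      nlinarith [hS, hdiv]
    · -- the claim below `p'`
      intro x hx3 hxp'
      simp only at hxp'
      rcases lt_or_ge x p with hxp | hxp
      · exact hclaim x hx3 hxp
      · have hx0 : 0 < x := by linarith
        have hlogx : 0 < Real.log x := Real.log_pos (by linarith)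
        have hrs : primeRecipSum x = ∑ q ∈ Nat.primesLE p, (q : ℝ)⁻¹ :=
          primeRecipSum_real_eq hnoprime hxp hxp'
        have hll : Real.log (Real.log x) < Real.log (Real.log (p' : ℝ)) :=
          Real.log_lt_log hlogx (Real.log_lt_log hx0 hxp')
        have hg3R : ((MHI : ℝ) + ((LL + dhi : ℕ) : ℝ)) ≤ S := by exact_mod_cast hg3
        rw [hrs]
        have hS' : (S : ℝ) / 2 ^ 80 ≤ ∑ q ∈ Nat.primesLE p, (q : ℝ)⁻¹ := by
          rw [div_le_iff₀ h80]; linarith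
        have hLL' : Real.log (Real.log (p' : ℝ)) ≤ ((LL + dhi : ℕ) : ℝ) / 2 ^ 80 := by
          rw [le_div_iff₀ h80]; linarith
        have : (MHI : ℝ) / 2 ^ 80 + ((LL + dhi : ℕ) : ℝ) / 2 ^ 80 ≤ (S : ℝ) / 2 ^ 80 := by
          rw [← add_div]; exact div_le_div_of_nonneg_right hg3R h80.le
        linarith

/-! ### The run -/

/-- **Soundness of a run** along the table cursor. [cite: Zhao2025MertensMean, §1.1 («E_i(x) > 0 for 2 ≤ x ≤ 10⁸» [RS])] -/
theorem run_sound : ∀ (fuel : ℕ) {s s' : ES}, Inv s → run fuel s (after s.p table) = some s' → Inv s'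
  | 0, s, s', hI, h => by
      simp only [run, Option.some.injEq] at h
      exact h ▸ hI
  | fuel + 1, s, s', hI, h => by
      rcases hseg : after s.p table with _ | ⟨p', rest⟩
      · rw [hseg] at h
        simp only [run, Option.some.injEq] at h
        exact h ▸ hI
      · rw [hseg] at h
        simp only [run] at h
        rcases hst : step s p' with _ | s₁
        · rw [hst] at h; simp at h
        · rw [hst] at h
          simp only at h
          obtain ⟨hI₁, hp₁⟩ := step_inv hI hseg hst
          have hrest : rest = after s₁.p table := by
            rw [hp₁]; exact tail_after tableOK.sorted hseg
          rw [hrest] at h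
          exact run_sound fuel hI₁ h

/-- **Soundness of a chunk**: `runD` preserves the invariant. [cite: Zhao2025MertensMean, §1.1 («E_i(x) > 0 for 2 ≤ x ≤ 10⁸» [RS])] -/
theorem runD_sound {fuel : ℕ} {s s' : ES} (hI : Inv s) (h : runD fuel s = some s') : Inv s' :=
  run_sound fuel hI h

/-! ### The initial state -/

/-- `logIv 3` (kernel). [folklore] -/
private theorem logIv_three :
    KernelLog.logIv 3 = some (1328140761516560292552947, 1328140761517035898327275) := by
  decide +kernel

/-- `logIv Lhi₃` (kernel; one logarithm of an 81-bit number, for `log log 3`). [folklore] -/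
private theorem logIv_Lhi3 :
    KernelLog.logIv 1328140761517035898327275 =
      some (67150778716844571176466832, 67150778716845046786013084) := by
  decide +kernel

/-- **The initial state (the prime `3`) satisfies the invariant.** [cite: Zhao2025MertensMean, §1.1 («E_i(x) > 0 for 2 ≤ x ≤ 10⁸» [RS])] -/
theorem initE_inv : Inv initE := by
  have hT := tableOK
  have h3 := KernelLog.logIv_sound logIv_three
  have e3 : ((3 : ℕ) : ℝ) = 3 := by norm_num
  have elo : ((1328140761516560292552947 : ℤ) : ℝ) = 1328140761516560292552947 := by norm_num
  have ehi : ((1328140761517035898327275 : ℤ) : ℝ) = 1328140761517035898327275 := by norm_num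
  rw [e3, elo, ehi] at h3
  have h80 : (0 : ℝ) < 2 ^ 80 := by positivity
  refine ⟨hT.complete 3 Nat.prime_three (by norm_num), Nat.prime_three, le_rfl, by decide, ?_, ?_, ?_, ?_, ?_⟩
  · simp only [initE]; push_cast
    have := h3.1; rw [div_le_iff₀ h80] at this; linarith
  · simp only [initE]; push_cast
    have := h3.2; rw [le_div_iff₀ h80] at this; linarith
  · -- `2⁸⁰ log log 3 ≤ LL₃ = hi₂ − 80·L2LON`
    simp only [initE]; push_cast
    have hl := KernelLog.logIv_sound logIv_Lhi3
    have hlog3 : 0 < Real.log 3 := Real.log_pos (by norm_num)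
    have e1 : Real.log (Real.log 3) ≤ Real.log ((1328140761517035898327275 : ℝ) / 2 ^ 80) :=
      Real.log_le_log hlog3 h3.2
    have e2 : Real.log ((1328140761517035898327275 : ℝ) / 2 ^ 80) =
        Real.log 1328140761517035898327275 - 80 * Real.log 2 := by
      rw [Real.log_div (by norm_num) h80.ne', Real.log_pow]; norm_num
    have e4 : Real.log ((1328140761517035898327275 : ℕ) : ℝ) ≤
        ((67150778716845046786013084 : ℤ) : ℝ) / 2 ^ 80 := hl.2
    have e5 : ((1328140761517035898327275 : ℕ) : ℝ) = 1328140761517035898327275 := by norm_num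
    rw [e5] at e4
    have hL2 := L2LON_le
    have e6 : (113696847084947482087084 : ℝ) = 67150778716845046786013084 - 80 * (L2LON : ℝ) := by
      norm_num [L2LON]
    rw [e6]
    rw [le_div_iff₀ h80] at e4
    nlinarith [e1, e2, e4, hL2]
  · -- `S₃ = ⌊2⁸⁰/2⌋ + ⌊2⁸⁰/3⌋ ≤ 2⁸⁰ (1/2 + 1/3)`
    simp only [initE, natdiv_eq, Nat.add_eq]
    have hset : Nat.primesLE 3 = {2, 3} := by decide
    rw [hset, Finset.sum_insert (by decide), Finset.sum_singleton]
    have h1 := (natDiv_real_bounds SC (by norm_num : 0 < 2)).1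
    have h2 := (natDiv_real_bounds SC (by norm_num : 0 < 3)).1
    rw [SC_real] at h1 h2
    push_cast at h1 h2 ⊢
    have : (2 : ℝ) ^ 80 / 2 + 2 ^ 80 / 3 = 2 ^ 80 * ((2 : ℝ)⁻¹ + (3 : ℝ)⁻¹) := by ring
    linarith
  · intro x hx hx3
    simp only [initE] at hx3
    push_cast at hx3
    linarith

/-! ### The conclusion from a state -/

/-- **The claim read off a state**: if `Inv s` then `MHI/2⁸⁰ + log log x < Σ_{q ≤ x} 1/q` for every real
`3 ≤ x < s.p`. [cite: Zhao2025MertensMean, §1.1 («E_i(x) > 0 for 2 ≤ x ≤ 10⁸» [RS])] -/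
theorem lt_primeRecipSum_of_inv {s : ES} (hI : Inv s) {x : ℝ} (h3 : 3 ≤ x) (hx : x < s.p) :
    (MHI : ℝ) / 2 ^ 80 + Real.log (Real.log x) < primeRecipSum x :=
  hI.claim x h3 hx

/-! ### The Meissel–Mertens constant: soundness of the accumulation -/

/-- `a_q = primeLogCoeffSubInv q = log(1 + 1/(q−1)) − 1/q` at a prime `q`. [cite: HardyWright2008, §22.7 eq. (22.7.1)] -/
theorem primeLogCoeffSubInv_eq {q : ℕ} (hq : q.Prime) :
    primeLogCoeffSubInv q = Real.log (1 + (1 : ℝ) / ((q : ℝ) - 1)) - (q : ℝ)⁻¹ := by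
  rw [primeLogCoeffSubInv, if_pos hq]
  have hq2 : (2 : ℝ) ≤ q := by exact_mod_cast hq.two_le
  have hq0 : (q : ℝ) ≠ 0 := by positivity
  have hq1 : (q : ℝ) - 1 ≠ 0 := by linarith
  have e1 : 1 - (q : ℝ)⁻¹ = ((q : ℝ) - 1) / q := by
    rw [sub_div, div_self hq0, one_div]
  have e2 : 1 + 1 / ((q : ℝ) - 1) = (q : ℝ) / ((q : ℝ) - 1) := by
    rw [eq_div_iff hq1, add_mul, one_mul, div_mul_cancel₀ _ hq1]
    ring
  rw [e1, e2, Real.log_div hq1 hq0, Real.log_div hq0 hq1]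
  ring

/-- `a_q ≥ 0` at a prime (indeed everywhere). [cite: HardyWright2008, §22.7 eq. (22.7.1)] -/
theorem primeLogCoeffSubInv_nonneg (q : ℕ) : 0 ≤ primeLogCoeffSubInv q := by
  by_cases hq : q.Prime
  · rw [primeLogCoeffSubInv_eq hq]
    have hq2 : (2 : ℝ) ≤ q := by exact_mod_cast hq.two_le
    have hpos : 0 < 1 + (1 : ℝ) / ((q : ℝ) - 1) := by
      have : 0 < (1 : ℝ) / ((q : ℝ) - 1) := by apply div_pos one_pos; linarith
      linarith
    have h := Real.one_sub_inv_le_log_of_pos hpos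
    have hq0 : (q : ℝ) ≠ 0 := by positivity
    have hq1 : (q : ℝ) - 1 ≠ 0 := by linarith
    have e2 : 1 + 1 / ((q : ℝ) - 1) = (q : ℝ) / ((q : ℝ) - 1) := by
      rw [eq_div_iff hq1, add_mul, one_mul, div_mul_cancel₀ _ hq1]
      ring
    have e : 1 - (1 + (1 : ℝ) / ((q : ℝ) - 1))⁻¹ = (q : ℝ)⁻¹ := by
      rw [e2, inv_div, one_sub_div hq0]
      have : (q : ℝ) - ((q : ℝ) - 1) = 1 := by ring
      rw [this, one_div]
    rw [e] at h
    linarith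
  · simp [primeLogCoeffSubInv, hq]

/-- Partial sums of `a` over the integers: if there is no prime in `(p, n)` then `Σ_{k<n} a_k = Σ_{k<p+1} a_k`.
[folklore] -/
private theorem sum_range_eq_of_noPrime {p : ℕ} :
    ∀ {n : ℕ}, p + 1 ≤ n → (∀ q : ℕ, p < q → q < n → ¬ q.Prime) →
      ∑ k ∈ Finset.range n, primeLogCoeffSubInv k = ∑ k ∈ Finset.range (p + 1), primeLogCoeffSubInv k
  | 0, h, _ => by omega
  | n + 1, h, hq => by
      rcases Nat.eq_or_lt_of_le h with heq | hlt
      · rw [heq]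
      · rw [Finset.sum_range_succ, sum_range_eq_of_noPrime (by omega) fun q h1 h2 => hq q h1 (by omega)]
        have : ¬ n.Prime := hq n (by omega) (by omega)
        simp [primeLogCoeffSubInv, this]

/-- **The invariant of the accumulation** at a state `⟨p, A, Ahi⟩`:
`A ≤ 2⁸⁰ (Σ_{k ≤ p} a_k − a_2) ≤ Ahi`. [cite: RosserSchoenfeld1962, (2.10) (the constant B)] -/
structure InvA (s : AS) : Prop where
  /-- the prime reached is a table entry -/
  mem : s.p ∈ table
  /-- and is prime -/
  prime : s.p.Prime
  /-- and is at least `3` -/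
  three_le : 3 ≤ s.p
  /-- lower bound -/
  A_le : (s.A : ℝ) ≤ 2 ^ 80 * ((∑ k ∈ Finset.range (s.p + 1), primeLogCoeffSubInv k) - primeLogCoeffSubInv 2)
  /-- upper bound -/
  le_Ahi : 2 ^ 80 * ((∑ k ∈ Finset.range (s.p + 1), primeLogCoeffSubInv k) - primeLogCoeffSubInv 2) ≤ s.Ahi

/-- The enclosure of one term: for a prime `p' ≥ 3` with `(lo, hi) = lnp 1 (p'−1)` and `⌊2⁸⁰/p'⌋ ≤ hi`,
`(lo − (⌊2⁸⁰/p'⌋ + 1) : ℕ) ≤ 2⁸⁰ a_{p'} ≤ (hi − ⌊2⁸⁰/p'⌋ : ℕ)`. [folklore] -/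
private theorem term_bounds {p' : ℕ} (hp' : p'.Prime) (h3 : 3 ≤ p') (hhi : SC / p' ≤ (lnp 1 (p' - 1)).2) :
    (((lnp 1 (p' - 1)).1 - (SC / p' + 1) : ℕ) : ℝ) ≤ 2 ^ 80 * primeLogCoeffSubInv p' ∧
      2 ^ 80 * primeLogCoeffSubInv p' ≤ (((lnp 1 (p' - 1)).2 - SC / p' : ℕ) : ℝ) := by
  have hq0 : 0 < p' - 1 := by omega
  have hq2 : 2 * 1 ≤ p' - 1 := by omega
  obtain ⟨hlo, hhi'⟩ := lnp_sound (p := 1) hq0 hq2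
  have hcast : ((p' - 1 : ℕ) : ℝ) = (p' : ℝ) - 1 := by
    rw [Nat.cast_sub (by omega)]; norm_num
  rw [hcast, Nat.cast_one] at hlo hhi'
  rw [primeLogCoeffSubInv_eq hp']
  obtain ⟨hd1, hd2⟩ := natDiv_real_bounds SC hp'.pos
  rw [SC_real] at hd1 hd2
  have hp'0 : (0 : ℝ) < p' := by exact_mod_cast hp'.pos
  have einv : (2 : ℝ) ^ 80 * (p' : ℝ)⁻¹ = 2 ^ 80 / p' := by rw [div_eq_mul_inv]
  constructor
  · by_cases hle : SC / p' + 1 ≤ (lnp 1 (p' - 1)).1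
    · rw [Nat.cast_sub hle]; push_cast
      rw [mul_sub, einv]; linarith
    · rw [Nat.sub_eq_zero_of_le (by omega)]; push_cast
      have := primeLogCoeffSubInv_nonneg p'
      rw [primeLogCoeffSubInv_eq hp'] at this
      positivity
  · rw [Nat.cast_sub hhi]
    rw [mul_sub, einv]; linarith

/-- **Soundness of one accumulation step.** [cite: RosserSchoenfeld1962, (2.10) (the constant B)] -/
theorem stepA_inv {s s' : AS} (hI : InvA s) {p' : ℕ} {rest : List ℕ}
    (hafter : after s.p table = p' :: rest) (h : stepA s p' = some s') : InvA s' ∧ s'.p = p' := by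
  have hT := tableOK
  obtain ⟨p, A, Ahi⟩ := s
  simp only at hafter hI
  obtain ⟨hmem, hprime, h3, hA, hAhi⟩ := hI
  simp only at hmem hprime h3 hA hAhi
  obtain ⟨hp'T, hpp', hmin⟩ := head_after hT.sorted hafter
  have hp'le : p' ≤ 4599989 := hT.bounded p' hp'T
  have hnoprime : ∀ q : ℕ, p < q → q < p' → ¬ q.Prime := fun q h1 h2 hq =>
    absurd (hmin q (hT.complete q hq (by omega)) h1) (not_le.2 h2)
  simp only [stepA, Nat.sub_eq, Nat.add_eq] at h
  obtain ⟨hg1, h⟩ := bif_not_none h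
  simp only [Bool.and_eq_true] at hg1
  obtain ⟨⟨-, hodd⟩, hchk⟩ := hg1
  have hodd' : Odd p' := Nat.odd_iff.2 (Nat.eq_of_beq_eq_true hodd)
  have hp'prime : p'.Prime := primeChk_sound hchk hodd' (by omega)
  rcases hlnp : lnp 1 (p' - 1) with ⟨alo, ahi⟩
  rw [hlnp] at h
  simp only at h
  obtain ⟨hg2, h⟩ := bif_not_none h
  simp only [Bool.and_eq_true, Nat.ble_eq, natdiv_eq] at hg2
  obtain ⟨hdivle, -⟩ := hg2
  simp only [Option.some.injEq] at h
  subst h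
  have h3' : 3 ≤ p' := by omega
  have htb := term_bounds hp'prime h3' (by rw [hlnp]; exact hdivle)
  rw [hlnp] at htb
  obtain ⟨ht1, ht2⟩ := htb
  -- `Σ_{k < p'+1} a_k = Σ_{k < p+1} a_k + a_{p'}`
  have hsum : ∑ k ∈ Finset.range (p' + 1), primeLogCoeffSubInv k =
      (∑ k ∈ Finset.range (p + 1), primeLogCoeffSubInv k) + primeLogCoeffSubInv p' := by
    rw [Finset.sum_range_succ, sum_range_eq_of_noPrime (by omega) hnoprime]
  refine ⟨⟨hp'T, hp'prime, h3', ?_, ?_⟩, rfl⟩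
  · simp only [natdiv_eq, hsum]
    push_cast
    nlinarith [hA, ht1]
  · simp only [natdiv_eq, hsum]
    push_cast
    nlinarith [hAhi, ht2]

/-- **Soundness of an accumulation run.** [cite: RosserSchoenfeld1962, (2.10) (the constant B)] -/
theorem runA_sound : ∀ (fuel : ℕ) {s s' : AS}, InvA s → runA fuel s (after s.p table) = some s' → InvA s'
  | 0, s, s', hI, h => by
      simp only [runA, Option.some.injEq] at h
      exact h ▸ hI
  | fuel + 1, s, s', hI, h => by
      rcases hseg : after s.p table with _ | ⟨p', rest⟩
      · rw [hseg] at h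
        simp only [runA, Option.some.injEq] at h
        exact h ▸ hI
      · rw [hseg] at h
        simp only [runA] at h
        rcases hst : stepA s p' with _ | s₁
        · rw [hst] at h; simp at h
        · rw [hst] at h
          simp only at h
          obtain ⟨hI₁, hp₁⟩ := stepA_inv hI hseg hst
          have hrest : rest = after s₁.p table := by
            rw [hp₁]; exact tail_after tableOK.sorted hseg
          rw [hrest] at h
          exact runA_sound fuel hI₁ h

/-- **Soundness of an accumulation chunk.** [cite: RosserSchoenfeld1962, (2.10) (the constant B)] -/
theorem runDA_sound {fuel : ℕ} {s s' : AS} (hI : InvA s) (h : runDA fuel s = some s') : InvA s' :=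
  runA_sound fuel hI h

/-- **The initial accumulation state (the prime `3`) satisfies the invariant.** [cite: RosserSchoenfeld1962, (2.10) (the constant B)] -/
theorem initA_inv : InvA initA := by
  have hT := tableOK
  rcases hlnp : lnp 1 2 with ⟨alo, ahi⟩
  have hval : initA = ⟨3, alo - (SC / 3 + 1), ahi - SC / 3⟩ := by
    simp [initA, hlnp, natdiv_eq]
  -- `⌊2⁸⁰/3⌋ ≤ hi`: from `2⁸⁰/3 ≤ 2⁸⁰ log(3/2) ≤ hi` (`log(3/2) ≥ 1 − 2/3`)
  have hdivle : SC / 3 ≤ (lnp 1 (3 - 1)).2 := by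
    have h32 : (3 - 1 : ℕ) = 2 := by norm_num
    rw [h32, hlnp]
    obtain ⟨-, hhi⟩ := lnp_sound (p := 1) (q := 2) (by norm_num) (by norm_num)
    rw [hlnp] at hhi
    have hl : (1 : ℝ) / 3 ≤ Real.log (1 + (1 : ℕ) / (2 : ℕ)) := by
      have := Real.one_sub_inv_le_log_of_pos (show (0 : ℝ) < 1 + (1 : ℕ) / (2 : ℕ) by norm_num)
      norm_num at this ⊢
      linarith
    have hd := (natDiv_real_bounds SC (by norm_num : 0 < 3)).1
    rw [SC_real] at hd
    have : ((SC / 3 : ℕ) : ℝ) ≤ (ahi : ℝ) := by push_cast at hd ⊢; nlinarith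
    exact_mod_cast this
  have htb := term_bounds Nat.prime_three le_rfl hdivle
  have h32 : (3 - 1 : ℕ) = 2 := by norm_num
  rw [h32, hlnp] at htb
  obtain ⟨ht1, ht2⟩ := htb
  have hsum : ∑ k ∈ Finset.range (3 + 1), primeLogCoeffSubInv k =
      primeLogCoeffSubInv 2 + primeLogCoeffSubInv 3 := by
    simp [Finset.sum_range_succ, primeLogCoeffSubInv, Nat.not_prime_zero, Nat.not_prime_one]
  rw [hval]
  refine ⟨hT.complete 3 Nat.prime_three (by norm_num), Nat.prime_three, le_rfl, ?_, ?_⟩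
  · simp only [hsum]; linarith
  · simp only [hsum]; linarith

/-! ### The Meissel–Mertens constant from a final accumulation state -/

/-- `γ − B = Σ_k a_k` (Hardy–Wright (22.8.1); the tree's `Mertens.tsum_primeLogCoeffSubInv`).
[cite: HardyWright2008, Thm 428 (§22.8) eq. (22.8.1)] -/
theorem eulerMascheroni_sub_meisselMertens_eq_tsum :
    Real.eulerMascheroniConstant - meisselMertens = ∑' k, primeLogCoeffSubInv k := by
  rw [tsum_primeLogCoeffSubInv, meisselMertens]; ring

/-- `a_2 = log 2 − 1/2`. [cite: HardyWright2008, §22.7 eq. (22.7.1)] -/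
theorem primeLogCoeffSubInv_two : primeLogCoeffSubInv 2 = Real.log 2 - 1 / 2 := by
  rw [primeLogCoeffSubInv_eq Nat.prime_two]
  norm_num

/-- The tail of `Σ a_k` beyond `N ≥ 2`: every partial sum `Σ_{i<n} a_{i+N} ≤ log N − log(N−1)` (telescoping with
`a_m ≤ [log m − log(m−1)] − [log(m+1) − log m]`, i.e. `1/m ≥ log(1 + 1/m)`). [folklore] -/
private theorem sum_range_shift_le {N : ℕ} (hN : 2 ≤ N) (n : ℕ) :
    ∑ i ∈ Finset.range n, primeLogCoeffSubInv (i + N) ≤ Real.log N - Real.log ((N : ℝ) - 1) := by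
  -- `a_m ≤ b_m := (log m − log(m−1)) − (log(m+1) − log m)` for `m ≥ 2`
  have hterm : ∀ m : ℕ, 2 ≤ m → primeLogCoeffSubInv m ≤
      (Real.log m - Real.log ((m : ℝ) - 1)) - (Real.log ((m : ℝ) + 1) - Real.log m) := by
    intro m hm
    have hm2 : (2 : ℝ) ≤ m := by exact_mod_cast hm
    have hm0 : (0 : ℝ) < m := by linarith
    have hm1 : (0 : ℝ) < (m : ℝ) - 1 := by linarith
    -- `log(m+1) − log m ≤ 1/m`
    have hup : Real.log ((m : ℝ) + 1) - Real.log m ≤ (m : ℝ)⁻¹ := by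
      rw [← Real.log_div (by linarith) hm0.ne']
      have := Real.log_le_sub_one_of_pos (show (0 : ℝ) < ((m : ℝ) + 1) / m by positivity)
      have e : ((m : ℝ) + 1) / m - 1 = (m : ℝ)⁻¹ := by field_simp; ring
      linarith
    by_cases hp : m.Prime
    · rw [primeLogCoeffSubInv_eq hp]
      have e : Real.log (1 + 1 / ((m : ℝ) - 1)) = Real.log m - Real.log ((m : ℝ) - 1) := by
        rw [← Real.log_div hm0.ne' hm1.ne']
        congr 1
        field_simp
        ring
      rw [e]
      linarith
    · simp only [primeLogCoeffSubInv, if_neg hp]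
      -- `0 ≤ b_m`: `log m − log(m−1) ≥ 1/m ≥ log(m+1) − log m`
      have hlow : (m : ℝ)⁻¹ ≤ Real.log m - Real.log ((m : ℝ) - 1) := by
        rw [← Real.log_div hm0.ne' hm1.ne']
        have := Real.one_sub_inv_le_log_of_pos (show (0 : ℝ) < (m : ℝ) / ((m : ℝ) - 1) by positivity)
        have e : 1 - ((m : ℝ) / ((m : ℝ) - 1))⁻¹ = (m : ℝ)⁻¹ := by field_simp; ring
        linarith
      linarith
  have hle : ∑ i ∈ Finset.range n, primeLogCoeffSubInv (i + N) ≤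
      ∑ i ∈ Finset.range n, ((Real.log ((i + N : ℕ) : ℝ) - Real.log (((i + N : ℕ) : ℝ) - 1)) -
        (Real.log (((i + N : ℕ) : ℝ) + 1) - Real.log ((i + N : ℕ) : ℝ))) :=
    Finset.sum_le_sum fun i _ => hterm (i + N) (by omega)
  refine hle.trans ?_
  -- telescoping: `Σ_{i<n} (g i − g (i+1)) = g 0 − g n` with `g i = log(i+N) − log(i+N−1)`
  have htel : ∑ i ∈ Finset.range n, ((Real.log ((i + N : ℕ) : ℝ) - Real.log (((i + N : ℕ) : ℝ) - 1)) -
      (Real.log (((i + N : ℕ) : ℝ) + 1) - Real.log ((i + N : ℕ) : ℝ))) =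
      (Real.log N - Real.log ((N : ℝ) - 1)) -
        (Real.log (((n + N : ℕ) : ℝ)) - Real.log (((n + N : ℕ) : ℝ) - 1)) := by
    set g : ℕ → ℝ := fun i => Real.log ((i + N : ℕ) : ℝ) - Real.log (((i + N : ℕ) : ℝ) - 1) with hg
    have ht := Finset.sum_range_sub' g n
    have hg0 : g 0 = Real.log N - Real.log ((N : ℝ) - 1) := by simp [hg]
    have hgn : g n = Real.log (((n + N : ℕ) : ℝ)) - Real.log (((n + N : ℕ) : ℝ) - 1) := by simp [hg]
    rw [← hg0, ← hgn, ← ht]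
    refine Finset.sum_congr rfl fun i _ => ?_
    have e1 : ((i + 1 + N : ℕ) : ℝ) = ((i + N : ℕ) : ℝ) + 1 := by push_cast; ring
    simp only [hg]
    rw [e1, add_sub_cancel_right]
  rw [htel]
  have hpos : 0 ≤ Real.log (((n + N : ℕ) : ℝ)) - Real.log (((n + N : ℕ) : ℝ) - 1) := by
    have h2 : (2 : ℝ) ≤ ((n + N : ℕ) : ℝ) := by exact_mod_cast (by omega : 2 ≤ n + N)
    have := Real.log_le_log (by linarith : (0 : ℝ) < ((n + N : ℕ) : ℝ) - 1)
      (by linarith : ((n + N : ℕ) : ℝ) - 1 ≤ ((n + N : ℕ) : ℝ))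
    linarith
  linarith

/-- **Upper bound for `B` from a final accumulation state**: if `InvA ⟨P, A, Ahi⟩` then
`γ − B ≥ (A + L2LON)/2⁸⁰ − 1/2`, i.e. `B ≤ γ − (A + L2LON)/2⁸⁰ + 1/2`.
[cite: RosserSchoenfeld1962, (2.10) (the constant B)] -/
theorem meisselMertens_le_of_invA {s : AS} (hI : InvA s) :
    meisselMertens ≤ Real.eulerMascheroniConstant - ((s.A : ℝ) + L2LON) / 2 ^ 80 + 1 / 2 := by
  have hsum : ∑ k ∈ Finset.range (s.p + 1), primeLogCoeffSubInv k ≤ ∑' k, primeLogCoeffSubInv k :=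
    summable_primeLogCoeffSubInv.sum_le_tsum _ fun k _ => primeLogCoeffSubInv_nonneg k
  have h := eulerMascheroni_sub_meisselMertens_eq_tsum
  have hA := hI.A_le
  have h2 := primeLogCoeffSubInv_two
  have hL := L2LON_le
  have h80 : (0 : ℝ) < 2 ^ 80 := by positivity
  have : ((s.A : ℝ) + L2LON) / 2 ^ 80 ≤
      (∑ k ∈ Finset.range (s.p + 1), primeLogCoeffSubInv k) - primeLogCoeffSubInv 2 + Real.log 2 := by
    rw [div_le_iff₀ h80]; nlinarith
  linarith

/-- **Lower bound for `B` from a final accumulation state**: if `InvA ⟨P, A, Ahi⟩` then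
`γ − B ≤ (Ahi + L2HIN)/2⁸⁰ − 1/2 + (log(P+1) − log P)`.
[cite: RosserSchoenfeld1962, (2.10) (the constant B)] -/
theorem le_meisselMertens_of_invA {s : AS} (hI : InvA s) :
    Real.eulerMascheroniConstant - ((s.Ahi : ℝ) + L2HIN) / 2 ^ 80 + 1 / 2 -
        (Real.log ((s.p : ℝ) + 1) - Real.log s.p) ≤ meisselMertens := by
  have hP : 2 ≤ s.p + 1 := by have := hI.three_le; omega
  have hsplit := (summable_primeLogCoeffSubInv).sum_add_tsum_nat_add (s.p + 1)
  have htail : ∑' i, primeLogCoeffSubInv (i + (s.p + 1)) ≤ Real.log ((s.p : ℝ) + 1) - Real.log s.p := by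
    have h := Real.tsum_le_of_sum_range_le (fun i => primeLogCoeffSubInv_nonneg (i + (s.p + 1)))
      (sum_range_shift_le hP)
    push_cast at h
    simpa using h
  have h := eulerMascheroni_sub_meisselMertens_eq_tsum
  have hA := hI.le_Ahi
  have h2 := primeLogCoeffSubInv_two
  have hL := le_L2HIN
  have h80 : (0 : ℝ) < 2 ^ 80 := by positivity
  have : (∑ k ∈ Finset.range (s.p + 1), primeLogCoeffSubInv k) - primeLogCoeffSubInv 2 + Real.log 2 ≤
      ((s.Ahi : ℝ) + L2HIN) / 2 ^ 80 := by
    rw [le_div_iff₀ h80]; nlinarith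
  linarith

end Literature.NumberTheory.LFunctions.MertensSecondChain

end
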